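import Mathlib
import Summits.AtomisticToContinuum.Crystallization.Theses.PhononSlackCertificates
import Summits.AtomisticToContinuum.Crystallization.Theorems.PhononSlackCertificatesFarFieldGapR
import Summits.AtomisticToContinuum.Crystallization.Theorems.PhononSlackCertificatesAllBadGap
import Summits.AtomisticToContinuum.Crystallization.Theorems.PhononSlackCertificatesNearFarGlueRNearFree
import Literature.MathematicalPhysics.StatisticalMechanics.LennardJonesClusters
import Literature.Geometry.DiscreteGeometry.TwoShellPatterns

/-!
# Crux `PhononSlackCertificates.NearFarGlueR` (stmt-AtomisticToContinuum-14970), line `Sketch`: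
the exact structure of the route's target

Continuation lead c1.  With the near-free glue
(`PhononSlackCertificatesNearFarGlueRNearFree.coerciveTwoShellGap_of_farFieldGapR_of_tightContactGap`),
the monotonicity `tightContactGap_of_coerciveTwoShellGap` (ReductionTight) and the sibling crux's
landed `farFieldGapR_of_coerciveTwoShellGap` / `farFieldGapR_iff_allBadGap`
(`PhononSlackCertificatesFarFieldGapR`), the route's target decomposes EXACTLY and unconditionally:

* `coerciveTwoShellGap_iff_farFieldGapR_and_tightContactGap : CoerciveTwoShellGap ↔ FarFieldGapR ∧ TightContactGap`;
* `coerciveTwoShellGap_iff_allBadGap_and_tightContactGap : CoerciveTwoShellGap ↔ AllBadGap ∧ TightContactGap`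
  (= the registered sub-goal `stub_structure` of the crux item).

So the engine of route `PhononSlackCertificates` is "matter with no 1/20-fcc/hcp two-shell
environment is uniformly worse per particle than `e*`" (`AllBadGap`, stmt-13960) plus "the first
contact layer of bad particles next to good crystal pays linearly" (`TightContactGap`, the registered
residual `stub_tightContactGap` of line `Sketch`, recommended for promotion) — and nothing else;
`NearFieldConvexity` serves `HullBridge` only (`crystallization_of_allBadGap_of_tightContactGap` runs the
route's `closes` from `AllBadGap` + `TightContactGap` in place of `FarFieldGapR` + `NearFarGlueR`).
`TightContactGap` is written out verbatim.
-/

noncomputable section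

namespace Summit.AtomisticToContinuum.Crystallization.Theorems.PhononSlackCertificatesNearFarGlueR

open Literature.MathematicalPhysics.StatisticalMechanics
open Literature.Geometry.DiscreteGeometry
open Summit.AtomisticToContinuum.Crystallization.Theses.PhononSlackCertificates
open scoped BigOperators

/-- **The target is EXACTLY far field ∧ tight contact gap** (unconditional equivalence of open
route statements): `CoerciveTwoShellGap ↔ FarFieldGapR ∧ TightContactGap`.  The direct
implications are `PhononSlackCertificatesFarFieldGapR.farFieldGapR_of_coerciveTwoShellGap` (sibling
crux) and `tightContactGap_of_coerciveTwoShellGap` (monotonicity of the count); the converse is the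
near-free glue. [folklore] -/
theorem coerciveTwoShellGap_iff_farFieldGapR_and_tightContactGap :
    CoerciveTwoShellGap ↔ FarFieldGapR ∧
      ∀ δ : ℝ, 0 < δ → ∃ g₂ : ℝ, 0 < g₂ ∧ ∀ (N : ℕ) (x : Fin N → EuclideanSpace ℝ (Fin 3)),
        (∀ i j : Fin N, i ≠ j → δ ≤ dist (x i) (x j)) →
        (N : ℝ) * (⨅ Q : PeriodicConfiguration 3, Q.energyPerParticle lennardJones)
          + g₂ * (Nat.card {j : Fin N // ¬ IsTwoShellGood (1 / 20) (47 / 50) 1 x j ∧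
              ∃ i : Fin N, IsTwoShellGood (1 / 20) (47 / 50) 1 x i ∧ dist (x i) (x j) ≤ 21 / 20} : ℝ)
          ≤ interactionEnergy lennardJones x :=
  ⟨fun h => ⟨PhononSlackCertificatesFarFieldGapR.farFieldGapR_of_coerciveTwoShellGap h,
      tightContactGap_of_coerciveTwoShellGap h⟩,
    fun h => coerciveTwoShellGap_of_farFieldGapR_of_tightContactGap h.1 h.2⟩

/-- **The target is EXACTLY all-bad bulk gap ∧ tight contact gap**:
`CoerciveTwoShellGap ↔ AllBadGap ∧ TightContactGap`, through the sibling crux's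
`farFieldGapR_iff_allBadGap`.  The route's engine is "matter with no 1/20-fcc/hcp two-shell
environment is uniformly worse per particle than `e*`" plus "the first contact layer of bad
particles next to good crystal pays linearly" — nothing else. [folklore] -/
theorem coerciveTwoShellGap_iff_allBadGap_and_tightContactGap :
    CoerciveTwoShellGap ↔ AllBadGap ∧
      ∀ δ : ℝ, 0 < δ → ∃ g₂ : ℝ, 0 < g₂ ∧ ∀ (N : ℕ) (x : Fin N → EuclideanSpace ℝ (Fin 3)),
        (∀ i j : Fin N, i ≠ j → δ ≤ dist (x i) (x j)) →
        (N : ℝ) * (⨅ Q : PeriodicConfiguration 3, Q.energyPerParticle lennardJones)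
          + g₂ * (Nat.card {j : Fin N // ¬ IsTwoShellGood (1 / 20) (47 / 50) 1 x j ∧
              ∃ i : Fin N, IsTwoShellGood (1 / 20) (47 / 50) 1 x i ∧ dist (x i) (x j) ≤ 21 / 20} : ℝ)
          ≤ interactionEnergy lennardJones x :=
  ⟨fun h => ⟨PhononSlackCertificatesAllBadGap.allBadGap_of_coerciveTwoShellGap h,
      tightContactGap_of_coerciveTwoShellGap h⟩,
    fun h => coerciveTwoShellGap_of_farFieldGapR_of_tightContactGap
      (PhononSlackCertificatesFarFieldGapR.FarFieldGapR_of h.1) h.2⟩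

/-- **Registered sub-goal `stub_structure` of the crux item** (line `Sketch`, continuation lead c1):
the route's target is EXACTLY all-bad bulk gap ∧ tight contact gap,
`coerciveTwoShellGap_iff_allBadGap_and_tightContactGap`. [folklore] -/
theorem stub_structure :
    CoerciveTwoShellGap ↔ AllBadGap ∧
      ∀ δ : ℝ, 0 < δ → ∃ g₂ : ℝ, 0 < g₂ ∧ ∀ (N : ℕ) (x : Fin N → EuclideanSpace ℝ (Fin 3)),
        (∀ i j : Fin N, i ≠ j → δ ≤ dist (x i) (x j)) →
        (N : ℝ) * (⨅ Q : PeriodicConfiguration 3, Q.energyPerParticle lennardJones)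
          + g₂ * (Nat.card {j : Fin N // ¬ IsTwoShellGood (1 / 20) (47 / 50) 1 x j ∧
              ∃ i : Fin N, IsTwoShellGood (1 / 20) (47 / 50) 1 x i ∧ dist (x i) (x j) ≤ 21 / 20} : ℝ)
          ≤ interactionEnergy lennardJones x :=
  coerciveTwoShellGap_iff_allBadGap_and_tightContactGap

/-- **How the deciding theorem re-points** (demonstration for the planner): with `AllBadGap` and the
tight contact gap as hypotheses IN PLACE OF `FarFieldGapR` and `NearFarGlueR`, the route's
`closes` goes through unchanged — `CoerciveTwoShellGap` by `stub_structure`, `FarFieldGapR` from the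
target (`farFieldGapR_of_coerciveTwoShellGap`), and the glue instantiated by the constant function.
CONDITIONAL on the six open route statements named as hypotheses. [folklore] -/
theorem crystallization_of_allBadGap_of_tightContactGap (hA : AllBadGap)
    (hT : ∀ δ : ℝ, 0 < δ → ∃ g₂ : ℝ, 0 < g₂ ∧ ∀ (N : ℕ) (x : Fin N → EuclideanSpace ℝ (Fin 3)),
      (∀ i j : Fin N, i ≠ j → δ ≤ dist (x i) (x j)) →
      (N : ℝ) * (⨅ Q : PeriodicConfiguration 3, Q.energyPerParticle lennardJones)
        + g₂ * (Nat.card {j : Fin N // ¬ IsTwoShellGood (1 / 20) (47 / 50) 1 x j ∧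
            ∃ i : Fin N, IsTwoShellGood (1 / 20) (47 / 50) 1 x i ∧ dist (x i) (x j) ≤ 21 / 20} : ℝ)
        ≤ interactionEnergy lennardJones x)
    (hNF : NearFieldConvexity) (hPGL : PeriodicGivenLayered) (hHB : HullBridge)
    (hWO : WindowOptimality) : _root_.Crystallization :=
  have hCG : CoerciveTwoShellGap := stub_structure.2 ⟨hA, hT⟩
  closes (PhononSlackCertificatesFarFieldGapR.farFieldGapR_of_coerciveTwoShellGap hCG) hNF
    (fun _ _ => hCG) hPGL hHB hWO

end Summit.AtomisticToContinuum.Crystallization.Theorems.PhononSlackCertificatesNearFarGlueR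

end
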